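import Literature.RepresentationTheory.BorelWallach2000.UpqTypeFunctoriality
import Summits.HodgeConjecture.HodgeConjecture.Theorems.F0P3bArchDegOnePackage
import Summits.HodgeConjecture.HodgeConjecture.Theorems.F0P3bStubT6aDegOneTypePure
import HarnessLib

/-!
# FLOOR-0 P3b «ENGINE local packets» — `J⁺ ≇ J⁻`: Hodge-type transport under `(𝔤, K)`-equivalence and the E2′-shaped
# consequence of T6a purity (F0P3b-plan (g3) edition-3 heads, THEOREMS-SIDE)

Cell hodgecm-mathlib (D-0151), FLOOR 0, crux item H413 = stmt-HodgeConjecture-24833.  Companion of ★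
`Theorems/F0P3bArchDegOnePackage.lean` (the proved T6 package; split off by the 400-line rule), author F0P3-p04 (g2);
statements = F0P3b-plan (g3)'s ed.-3 sketch §4 (`upqTypeClasses_ne_bot_of_gkEquiv`, `hol_antihol_inequivalent_of`,
`antihol_hol_inequivalent_of`, VERBATIM) plus the UNCONDITIONAL forms (T6a is the theorem
`F0P3bArchDegOnePackage.stub_T6a_degOneTypePure`): an irreducible unitary `(𝔤, K)`-module of `U(2,1)` with a non-zero
`(1,0)`-class and one with a non-zero `(0,1)`-class are not `(𝔤, K)`-equivalent — the module-level half of letter E2′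
`hodgeTypeRigid` (the diagonal case E2′₀ of ENGINE-INTERFACES §7b).  Transport = ★ `GKEquiv.upqTypeClassesEquiv`
(`UpqTypeFunctoriality`). [cite: Rogawski1990, Prop. 15.2.1 (b); §15.3 ¶1] [cite: BorelWallach2000, II §4.2 (3); I §4.3]

HONEST LABEL: HC_CM is proved only modulo the printed citations until rung 0 closes; this file discharges none of them.
-/

set_option autoImplicit false
set_option linter.dupNamespace false

noncomputable section

namespace Summit.HodgeConjecture.HodgeConjecture.Cruxes.H413.F0P3bArchDegOnePackage

open Literature.Algebra.Lie Literature.Algebra.Lie.ChevalleyEilenberg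
open Literature.NumberTheory.Automorphic
open Literature.RepresentationTheory.BorelWallach2000
open Literature.RepresentationTheory.KonnoKonno2007 Literature.RepresentationTheory.KonnoKonno2007.RealDualPair
open Literature.RepresentationTheory.KonnoKonno2007.RealDualPair.UForm

-- Mathlib idiom (as in `GKModules`, `GKCohomology`, the `Upq*` files): commutator bracket on `Module.End`
attribute [local instance 100] LieRing.ofAssociativeRing

section EditionThree

variable {α β : Type*} [Fintype α] [DecidableEq α] [Fintype β] [DecidableEq β]
  {V : Type*} [AddCommGroup V] [Module ℂ V]
  {ρK : Representation ℂ (uFormGroup α β).maximalCompact V}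
  {ρ𝔤 : (uFormGroup α β).lie →ₗ⁅ℝ⁆ Module.End ℂ V}
  {V' : Type*} [AddCommGroup V'] [Module ℂ V']
  {ρK' : Representation ℂ (uFormGroup α β).maximalCompact V'}
  {ρ𝔤' : (uFormGroup α β).lie →ₗ⁅ℝ⁆ Module.End ℂ V'}

/-- A `(𝔤, K)`-equivalence of `U(α, β)`-pair data transports «`H^n_δ(V) ≠ 0`» (generic; from ★ `GKEquiv.upqTypeClassesEquiv`).
[cite: BorelWallach2000, II §4.2 (3); I §4.3] -/
theorem upqTypeClasses_ne_bot_of_gkEquiv (hGK : IsGKModule (uFormGroup α β) ρK ρ𝔤)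
    (hGK' : IsGKModule (uFormGroup α β) ρK' ρ𝔤') (e : GKEquiv ρK ρ𝔤 ρK' ρ𝔤') {n : ℕ} {δ : ℤ}
    (h : upqTypeClasses ρK ρ𝔤 hGK.ad_compat n δ ≠ ⊥) : upqTypeClasses ρK' ρ𝔤' hGK'.ad_compat n δ ≠ ⊥ := by
  obtain ⟨x, hx, hx0⟩ := (Submodule.ne_bot_iff _).1 h
  refine (Submodule.ne_bot_iff _).2 ⟨_, ((e.upqTypeClassesEquiv hGK.ad_compat hGK'.ad_compat n δ) ⟨x, hx⟩).2, ?_⟩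
  intro h0
  have h1 : (e.upqTypeClassesEquiv hGK.ad_compat hGK'.ad_compat n δ) ⟨x, hx⟩ = 0 := Subtype.ext h0
  have h2 : (⟨x, hx⟩ : upqTypeClasses ρK ρ𝔤 hGK.ad_compat n δ) = 0 := (LinearEquiv.map_eq_zero_iff _).1 h1
  exact hx0 (congrArg Subtype.val h2)

end EditionThree

section EditionThreeU21

variable {V : Type} [AddCommGroup V] [Module ℂ V]
  {ρK : Representation ℂ (uFormGroup (Fin 2) (Fin 1)).maximalCompact V}
  {ρ𝔤 : (uFormGroup (Fin 2) (Fin 1)).lie →ₗ⁅ℝ⁆ Module.End ℂ V}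
  {V' : Type} [AddCommGroup V'] [Module ℂ V']
  {ρK' : Representation ℂ (uFormGroup (Fin 2) (Fin 1)).maximalCompact V'}
  {ρ𝔤' : (uFormGroup (Fin 2) (Fin 1)).lie →ₗ⁅ℝ⁆ Module.End ℂ V'}

/-- **E2′-shaped consequence of T6a (hol ≠ antihol at the module level)**: an irreducible unitary `(𝔤, K)`-module of
`U(2,1)` with a non-zero `(1,0)`-class and one with a non-zero `(0,1)`-class are NOT `(𝔤, K)`-equivalent — transport the
`(1,0)`-class along the equivalence and apply T6a purity to the second module. [cite: Rogawski1990, Prop. 15.2.1 (b)]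
[cite: BorelWallach2000, II §4.2 (3)] -/
theorem hol_antihol_inequivalent_of (h6a : StubT6aDegOneTypePure) (h : IsCohUnitaryIrrep ρK ρ𝔤)
    (h' : IsCohUnitaryIrrep ρK' ρ𝔤')
    (hV : upqTypeClasses ρK ρ𝔤 h.gk.ad_compat 1 1 ≠ ⊥) (hV' : upqTypeClasses ρK' ρ𝔤' h'.gk.ad_compat 1 (-1) ≠ ⊥) :
    ¬ AreGKEquivalent ρK ρ𝔤 ρK' ρ𝔤' := by
  rintro ⟨e⟩
  exact not_both_types_of_T6a ρK' ρ𝔤' h6a h' ⟨upqTypeClasses_ne_bot_of_gkEquiv h.gk h'.gk e hV, hV'⟩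

/-- The same with the roles exchanged (antihol source, hol target). [cite: Rogawski1990, Prop. 15.2.1 (b)] -/
theorem antihol_hol_inequivalent_of (h6a : StubT6aDegOneTypePure) (h : IsCohUnitaryIrrep ρK ρ𝔤)
    (h' : IsCohUnitaryIrrep ρK' ρ𝔤')
    (hV : upqTypeClasses ρK ρ𝔤 h.gk.ad_compat 1 (-1) ≠ ⊥) (hV' : upqTypeClasses ρK' ρ𝔤' h'.gk.ad_compat 1 1 ≠ ⊥) :
    ¬ AreGKEquivalent ρK ρ𝔤 ρK' ρ𝔤' := by
  rintro ⟨e⟩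
  exact not_both_types_of_T6a ρK' ρ𝔤' h6a h' ⟨hV', upqTypeClasses_ne_bot_of_gkEquiv h.gk h'.gk e hV⟩

/-- **`J⁺ ≇ J⁻` (unconditional)**: an irreducible unitary `(𝔤, K)`-module of `U(2,1)` with a non-zero `(1,0)`-class and one
with a non-zero `(0,1)`-class are not `(𝔤, K)`-equivalent (T6a is ★ `stub_T6a_degOneTypePure`). [cite: Rogawski1990, Prop. 15.2.1 (b)] -/
theorem hol_antihol_inequivalent (h : IsCohUnitaryIrrep ρK ρ𝔤) (h' : IsCohUnitaryIrrep ρK' ρ𝔤')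
    (hV : upqTypeClasses ρK ρ𝔤 h.gk.ad_compat 1 1 ≠ ⊥) (hV' : upqTypeClasses ρK' ρ𝔤' h'.gk.ad_compat 1 (-1) ≠ ⊥) :
    ¬ AreGKEquivalent ρK ρ𝔤 ρK' ρ𝔤' :=
  hol_antihol_inequivalent_of stub_T6a_degOneTypePure h h' hV hV'

/-- The same with the roles exchanged (unconditional). [cite: Rogawski1990, Prop. 15.2.1 (b)] -/
theorem antihol_hol_inequivalent (h : IsCohUnitaryIrrep ρK ρ𝔤) (h' : IsCohUnitaryIrrep ρK' ρ𝔤')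
    (hV : upqTypeClasses ρK ρ𝔤 h.gk.ad_compat 1 (-1) ≠ ⊥) (hV' : upqTypeClasses ρK' ρ𝔤' h'.gk.ad_compat 1 1 ≠ ⊥) :
    ¬ AreGKEquivalent ρK ρ𝔤 ρK' ρ𝔤' :=
  antihol_hol_inequivalent_of stub_T6a_degOneTypePure h h' hV hV'

end EditionThreeU21

/-! ## Edition 2 (A-p09 (g19), reviewer note on p797233): the same for EVERY `U(α, β)` and ANY `(𝔤, K)`-modules, irreducibility of
the target only — no unitarity, no admissibility (purity is p01 (g2)՚s ★ `F0P3bStubT6aDegOneTypePure.typeClasses_one_eq_bot_or`). -/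

section EditionTwoGeneric

variable {α β : Type} [Fintype α] [DecidableEq α] [Fintype β] [DecidableEq β]
  {V : Type} [AddCommGroup V] [Module ℂ V]
  {ρK : Representation ℂ (uFormGroup α β).maximalCompact V}
  {ρ𝔤 : (uFormGroup α β).lie →ₗ⁅ℝ⁆ Module.End ℂ V}
  {V' : Type} [AddCommGroup V'] [Module ℂ V']
  {ρK' : Representation ℂ (uFormGroup α β).maximalCompact V'}
  {ρ𝔤' : (uFormGroup α β).lie →ₗ⁅ℝ⁆ Module.End ℂ V'}

/-- **`H¹_{+1} ≠ 0` and `H¹_{−1} ≠ 0` modules are inequivalent** for every `U(α, β)`: a `(𝔤, K)`-module with a non-zero `(1,0)`-class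
is not `(𝔤, K)`-equivalent to an IRREDUCIBLE `(𝔤, K)`-module with a non-zero `(0,1)`-class (transport ★ `upqTypeClasses_ne_bot_of_gkEquiv`
+ purity ★ `typeClasses_one_eq_bot_or`; the source binder is used only through `IsGKModule.ad_compat`).
[cite: Rogawski1990, Prop. 15.2.1 (b)] [cite: BorelWallach2000, II §4.2 (3)] -/
theorem hol_antihol_inequivalent_of_irreducible (hGK : IsGKModule (uFormGroup α β) ρK ρ𝔤)
    (hGK' : IsGKModule (uFormGroup α β) ρK' ρ𝔤') (hirr' : IsIrreducibleGK ρK' ρ𝔤')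
    (hV : upqTypeClasses ρK ρ𝔤 hGK.ad_compat 1 1 ≠ ⊥) (hV' : upqTypeClasses ρK' ρ𝔤' hGK'.ad_compat 1 (-1) ≠ ⊥) :
    ¬ AreGKEquivalent ρK ρ𝔤 ρK' ρ𝔤' := by
  rintro ⟨e⟩
  rcases F0P3bStubT6aDegOneTypePure.typeClasses_one_eq_bot_or ρK' ρ𝔤' hGK'.ad_compat hirr' with h | h
  · exact upqTypeClasses_ne_bot_of_gkEquiv hGK hGK' e hV h
  · exact hV' h

/-- The same with the roles of the types exchanged: a `(𝔤, K)`-module with a non-zero `(0,1)`-class is not equivalent to an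
irreducible one with a non-zero `(1,0)`-class. [cite: Rogawski1990, Prop. 15.2.1 (b)] [cite: BorelWallach2000, II §4.2 (3)] -/
theorem antihol_hol_inequivalent_of_irreducible (hGK : IsGKModule (uFormGroup α β) ρK ρ𝔤)
    (hGK' : IsGKModule (uFormGroup α β) ρK' ρ𝔤') (hirr' : IsIrreducibleGK ρK' ρ𝔤')
    (hV : upqTypeClasses ρK ρ𝔤 hGK.ad_compat 1 (-1) ≠ ⊥) (hV' : upqTypeClasses ρK' ρ𝔤' hGK'.ad_compat 1 1 ≠ ⊥) :
    ¬ AreGKEquivalent ρK ρ𝔤 ρK' ρ𝔤' := by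
  rintro ⟨e⟩
  rcases F0P3bStubT6aDegOneTypePure.typeClasses_one_eq_bot_or ρK' ρ𝔤' hGK'.ad_compat hirr' with h | h
  · exact hV' h
  · exact upqTypeClasses_ne_bot_of_gkEquiv hGK hGK' e hV h

/-- **Irreducible source version**: two IRREDUCIBLE `(𝔤, K)`-modules of `U(α, β)`, one with a non-zero `(1,0)`-class and one with a
non-zero `(0,1)`-class, are inequivalent in either direction. [cite: Rogawski1990, Prop. 15.2.1 (b)] -/
theorem not_areGKEquivalent_of_types (hGK : IsGKModule (uFormGroup α β) ρK ρ𝔤)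
    (hGK' : IsGKModule (uFormGroup α β) ρK' ρ𝔤') (hirr : IsIrreducibleGK ρK ρ𝔤) (hirr' : IsIrreducibleGK ρK' ρ𝔤')
    (hV : upqTypeClasses ρK ρ𝔤 hGK.ad_compat 1 1 ≠ ⊥) (hV' : upqTypeClasses ρK' ρ𝔤' hGK'.ad_compat 1 (-1) ≠ ⊥) :
    ¬ AreGKEquivalent ρK ρ𝔤 ρK' ρ𝔤' ∧ ¬ AreGKEquivalent ρK' ρ𝔤' ρK ρ𝔤 :=
  ⟨hol_antihol_inequivalent_of_irreducible hGK hGK' hirr' hV hV',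
    antihol_hol_inequivalent_of_irreducible hGK' hGK hirr hV' hV⟩

end EditionTwoGeneric

end Summit.HodgeConjecture.HodgeConjecture.Cruxes.H413.F0P3bArchDegOnePackage


end
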